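import Summits.CriticalPhenomena.PercolationContinuityZ3.Theorems.PercNearOneGluingNoHeavyLowerTailThreePointHalvingCross
import Summits.CriticalPhenomena.PercolationContinuityZ3.Theorems.PercNearOneGluingNoHeavyLowerTailOneLayerTwoFingerTools
import HarnessLib

/-!
# The SHARP cross inequality `F(G∖e) + F(G/e) ≥ 4·I_U(e)·I_D(e)` at the terminal pairs `e = as` (and `ac`, `sc`), every weighted graph
# (Sahi programme, prover prim-sahi-p2 gen 46)

Support file (`--supports stmt-CriticalPhenomena-4575`, helper), continuing `…ThreePointHalvingCross` (prim-sahi-p2 gen 45: the pencil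
identity `F = (1−p)²F₀ + p²F₁ + p(1−p)(F₀ + F₁ − I_U I_D)` along a pair and the schema `halvingUD_of_cross`).  No definitions, no named
facts, no sorries; standard axioms.  Memo `run/shared/lean/prim/prim-sahi/FROM-prim-sahi-p2-gen46-TWO-HUB-PIECE.md` (§2, STAR-4 / (XI♯)).

With `U = {s↔a} ∪ {c↔a}`, `D = {s↮c}`, `X = U ∩ D`, `F(P) = 2P(X) − P(U)P(D)`, `μ = P_{w[e↦0]}`, `ν = P_{w[e↦1]}`, `I_U = ν(U) − μ(U)`,
`I_D = μ(D) − ν(D)`, gen 45's conjecture (XI♯) — numerically `inf (F(μ)+F(ν))/(I_U I_D) = 4` over all pairs of all graphs, equality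
approached on the path `s–a–c` at the pair `as` with `w(ac) = ½` — strengthens the cross inequality (XI) `F(μ) + F(ν) ≥ I_U I_D` that
drives `halvingUD_of_cross`.  Gen 46's kit census (j333375) found the same infimum `4` for the whole `a`-star aggregate (STAR-4).
* `cross_sharp_at_as` [this work] — **(XI♯) IS A THEOREM AT THE PAIR `e = s(a,s)`**: `4·I_U·I_D ≤ F(μ) + F(ν)` for every weight function
  on every finite vertex type.  Proof: under `ν` the pair is open a.s., so `ν(U) = 1` and `ν(D) = ν(X) = μ(c ↮ s, c ↮ a)` (the event
  "`c` separated from `{a,s}`" does not depend on the pair `as`: `determinedBy_sep_pair`); on the `μ`-side, with `P₂ = μ(s↮c, a↔c)`,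
  `P₁ = μ(s↮c, a↮c, a↔s)`, `C = μ(c↮s, c↮a)`, `A = μ(Uᶜ)`, the claim is `P₂(3A−1) ≤ 2P₁ + A·C`, and Harris (`{a↔c}` increasing,
  "`s` isolated" decreasing) gives `P₂ ≤ (1−A)·μ(s isolated)`, whence the slack is `≥ (2+A)P₁ + μ(s isolated)·(2A−1)²`.
  Equality structure: `A = ½`, `P₁ = 0`, Harris tight — the path at `w(ac) = ½`.
* `infl_U_at_sc_eq_zero` [this work] — at `e = s(s,c)` the influence `I_U` vanishes: `ν(U) = μ(U)` (whether `a` reaches `{s,c}` ignores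
  the pair `sc`, `determinedBy_U_pair`), so there (XI♯) and (XI) both read `0 ≤ F(μ) + F(ν)`.
The interior / `a`–non-terminal pairs (the real content of (XI♯) and STAR-4) remain OPEN; nothing here asserts them.
-/

noncomputable section

namespace Summit.CriticalPhenomena.PercolationContinuityZ3.Theorems

namespace HalvingCross

open MeasureTheory Set Literature.Probability.Percolation Literature.Probability.LatticeModels
open scoped Classical

variable {V : Type*} [Fintype V] [DecidableEq V]

/-! ## The event "`c` separated from `{a, s}`" ignores the pair `as` -/

omit [Fintype V] [DecidableEq V] in
/-- A walk to `a` or `s` yields, from any start outside `{a,s}`, a walk to `a` or `s` avoiding the pair `s(a,s)`. [this work] -/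
theorem reach_pair_avoiding (ω : BondConfig V) (a s : V) {x t : V} (p : (openGraph ω).Walk x t) (ht : t = a ∨ t = s) :
    x = a ∨ x = s ∨ (openGraph (ω \ {s(a, s)})).Reachable x a ∨ (openGraph (ω \ {s(a, s)})).Reachable x s := by
  induction p with
  | nil =>
      rcases ht with h | h
      · exact Or.inl h
      · exact Or.inr (Or.inl h)
  | @cons u v _ hadj _ ih =>
      by_cases hu : u = a ∨ u = s
      · rcases hu with h | h
        · exact Or.inl h
        · exact Or.inr (Or.inl h)
      · simp only [not_or] at hu
        have hadj' : (openGraph (ω \ {s(a, s)})).Adj u v := by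
          rw [openGraph_adj] at hadj ⊢
          refine ⟨⟨hadj.1, fun h => ?_⟩, hadj.2⟩
          rw [mem_singleton_iff] at h
          rcases Sym2.eq_iff.1 h with ⟨h1, -⟩ | ⟨h1, -⟩
          · exact hu.1 h1
          · exact hu.2 h1
        rcases ih ht with h | h | h | h
        · subst h; exact Or.inr (Or.inr (Or.inl hadj'.reachable))
        · subst h; exact Or.inr (Or.inr (Or.inr hadj'.reachable))
        · exact Or.inr (Or.inr (Or.inl (hadj'.reachable.trans h)))
        · exact Or.inr (Or.inr (Or.inr (hadj'.reachable.trans h)))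

omit [Fintype V] [DecidableEq V] in
/-- "`c` is separated from `s` and from `a`" is determined by the pairs other than `s(a,s)`. [this work] -/
theorem determinedBy_sep_pair {a s c : V} (hca : c ≠ a) (hcs : c ≠ s) :
    DeterminedBy ((openConn s c)ᶜ ∩ (openConn c a)ᶜ : Set (BondConfig V)) ({s(a, s)} : Set (Sym2 V))ᶜ := by
  rw [determinedBy_iff]
  -- it suffices to transport "c reaches a or s" along agreement off the pair
  have key : ∀ ω ω' : BondConfig V, ω ∩ ({s(a, s)} : Set (Sym2 V))ᶜ = ω' ∩ ({s(a, s)} : Set (Sym2 V))ᶜ →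
      ω ∉ ((openConn s c)ᶜ ∩ (openConn c a)ᶜ : Set (BondConfig V)) → ω' ∉ ((openConn s c)ᶜ ∩ (openConn c a)ᶜ : Set (BondConfig V)) := by
    intro ω ω' hF hω hω'
    have hsub : ω \ {s(a, s)} ⊆ ω' := by
      intro e he
      have : e ∈ ω' ∩ ({s(a, s)} : Set (Sym2 V))ᶜ := by rw [← hF]; exact ⟨he.1, he.2⟩
      exact this.1
    have hmono : (openGraph (ω \ {s(a, s)})) ≤ openGraph ω' := openGraph_mono hsub
    simp only [mem_inter_iff, mem_compl_iff, openConn, mem_setOf_eq, not_and_or, not_not] at hω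
    rcases hω with h | h
    · obtain ⟨p⟩ := h.symm
      rcases reach_pair_avoiding ω a s p (Or.inr rfl) with h1 | h1 | h1 | h1
      · exact hca h1
      · exact hcs h1
      · exact hω'.2 (h1.mono hmono)
      · exact hω'.1 (h1.mono hmono).symm
    · obtain ⟨p⟩ := h
      rcases reach_pair_avoiding ω a s p (Or.inl rfl) with h1 | h1 | h1 | h1
      · exact hca h1
      · exact hcs h1
      · exact hω'.2 (h1.mono hmono)
      · exact hω'.1 (h1.mono hmono).symm
  intro ω ω' hF
  constructor
  · intro h; by_contra h'; exact key ω' ω hF.symm h' h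
  · intro h; by_contra h'; exact key ω ω' hF h' h

/-! ## The two measures at the pair `as` -/

section measures
variable (w : Sym2 V → unitInterval) {a s c : V}

/-- Under `ν = P_{w[as ↦ 1]}` the pair `as` is open almost surely: `ν(E) = ν(E ∩ {as open})`. [this work] -/
theorem real_eq_real_inter_open (E : Set (BondConfig V)) :
    (prodBernoulli (Function.update w s(a, s) 1)).real E =
      (prodBernoulli (Function.update w s(a, s) 1)).real (E ∩ {ω | s(a, s) ∈ ω}) := by
  set ν := prodBernoulli (Function.update w s(a, s) 1) with hν
  have h1 : ν.real {ω : BondConfig V | s(a, s) ∈ ω} = 1 := by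
    rw [hν, prodBernoulli_real_setOf_mem]; simp
  have h0 : ν.real {ω : BondConfig V | s(a, s) ∈ ω}ᶜ = 0 := by
    rw [probReal_compl_eq_one_sub MeasurableSet.of_discrete, h1, sub_self]
  have hsplit := measureReal_inter_add_sdiff (μ := ν) (s := E) (t := {ω : BondConfig V | s(a, s) ∈ ω}) MeasurableSet.of_discrete
  have hle : ν.real (E \ {ω : BondConfig V | s(a, s) ∈ ω}) ≤ 0 := by
    calc ν.real (E \ {ω : BondConfig V | s(a, s) ∈ ω}) ≤ ν.real {ω : BondConfig V | s(a, s) ∈ ω}ᶜ :=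
          measureReal_mono (fun ω hω => hω.2)
      _ = 0 := h0
  have hge : 0 ≤ ν.real (E \ {ω : BondConfig V | s(a, s) ∈ ω}) := measureReal_nonneg
  linarith

omit [Fintype V] in
/-- `ν(U) = 1`: with `as` open, `a ↔ s`. [this work] -/
theorem nu_real_U (has : a ≠ s) :
    (prodBernoulli (Function.update w s(a, s) 1)).real (openConn s a ∪ openConn c a : Set (BondConfig V)) = 1 := by
  refine le_antisymm measureReal_le_one ?_
  have h1 : (prodBernoulli (Function.update w s(a, s) 1)).real {ω : BondConfig V | s(a, s) ∈ ω} = 1 := by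
    rw [prodBernoulli_real_setOf_mem]; simp
  rw [← h1]
  refine measureReal_mono fun ω hω => Or.inl ?_
  have he : s(s, a) ∈ ω := by rw [Sym2.eq_swap]; exact hω
  exact SimpleGraph.Adj.reachable ((openGraph_adj ω s a).2 ⟨he, fun h => has h.symm⟩)

/-- `ν(D) = μ(c ↮ s, c ↮ a)`: with `as` open, `s ↮ c` iff `c` is separated from `{a,s}`, an event that ignores the pair. [this work] -/
theorem nu_real_D (has : a ≠ s) (hca : c ≠ a) (hcs : c ≠ s) :
    (prodBernoulli (Function.update w s(a, s) 1)).real ((openConn s c)ᶜ : Set (BondConfig V)) =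
      (prodBernoulli (Function.update w s(a, s) 0)).real ((openConn s c)ᶜ ∩ (openConn c a)ᶜ : Set (BondConfig V)) := by
  rw [real_eq_real_inter_open]
  have hset : ((openConn s c)ᶜ : Set (BondConfig V)) ∩ {ω | s(a, s) ∈ ω} = ((openConn s c)ᶜ ∩ (openConn c a)ᶜ) ∩ {ω | s(a, s) ∈ ω} := by
    ext ω
    simp only [mem_inter_iff, mem_compl_iff, openConn, mem_setOf_eq]
    constructor
    · rintro ⟨hsc, he⟩
      refine ⟨⟨hsc, fun hcaR => hsc ?_⟩, he⟩
      have hsa : (openGraph ω).Reachable s a :=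
        SimpleGraph.Adj.reachable ((openGraph_adj ω s a).2 ⟨by rw [Sym2.eq_swap]; exact he, fun h => has h.symm⟩)
      exact hsa.trans hcaR.symm
    · rintro ⟨⟨hsc, -⟩, he⟩; exact ⟨hsc, he⟩
  rw [hset, OneLayerTwoFinger.real_inter_mem _ _ (determinedBy_sep_pair hca hcs)]
  simp only [Function.update_self, Set.Icc.coe_one, mul_one]
  exact prodBernoulli_real_eq_of_determinedBy _ _ (fun i hi => by
    rw [Function.update_of_ne (fun h => hi (mem_singleton_iff.2 h)), Function.update_of_ne (fun h => hi (mem_singleton_iff.2 h))])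
    (determinedBy_sep_pair hca hcs) MeasurableSet.of_discrete

/-- `ν(X) = ν(D)` (`U` is `ν`-almost sure). [this work] -/
theorem nu_real_X (has : a ≠ s) :
    (prodBernoulli (Function.update w s(a, s) 1)).real ((openConn s a ∪ openConn c a) ∩ (openConn s c)ᶜ : Set (BondConfig V)) =
      (prodBernoulli (Function.update w s(a, s) 1)).real ((openConn s c)ᶜ : Set (BondConfig V)) := by
  rw [real_eq_real_inter_open w ((openConn s a ∪ openConn c a) ∩ (openConn s c)ᶜ), real_eq_real_inter_open w ((openConn s c)ᶜ)]
  congr 1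
  ext ω
  simp only [mem_inter_iff, mem_union, mem_compl_iff, openConn, mem_setOf_eq]
  constructor
  · rintro ⟨⟨-, h⟩, he⟩; exact ⟨h, he⟩
  · rintro ⟨h, he⟩
    exact ⟨⟨Or.inl (SimpleGraph.Adj.reachable ((openGraph_adj ω s a).2 ⟨by rw [Sym2.eq_swap]; exact he, fun h => has h.symm⟩)), h⟩, he⟩

omit [Fintype V] [DecidableEq V] in
/-- "`a` reaches `s` or `c`" is determined by the pairs other than `s(s,c)`. [this work] -/
theorem determinedBy_U_pair (has : a ≠ s) (hac : a ≠ c) :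
    DeterminedBy (openConn s a ∪ openConn c a : Set (BondConfig V)) ({s(s, c)} : Set (Sym2 V))ᶜ := by
  rw [determinedBy_iff]
  have key : ∀ ω ω' : BondConfig V, ω ∩ ({s(s, c)} : Set (Sym2 V))ᶜ = ω' ∩ ({s(s, c)} : Set (Sym2 V))ᶜ →
      ω ∈ (openConn s a ∪ openConn c a : Set (BondConfig V)) → ω' ∈ (openConn s a ∪ openConn c a : Set (BondConfig V)) := by
    intro ω ω' hF hω
    have hsub : ω \ {s(s, c)} ⊆ ω' := by
      intro e he
      have : e ∈ ω' ∩ ({s(s, c)} : Set (Sym2 V))ᶜ := by rw [← hF]; exact ⟨he.1, he.2⟩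
      exact this.1
    have hmono : (openGraph (ω \ {s(s, c)})) ≤ openGraph ω' := openGraph_mono hsub
    simp only [mem_union, openConn, mem_setOf_eq] at hω ⊢
    rcases hω with h | h
    · obtain ⟨p⟩ := h.symm
      rcases reach_pair_avoiding ω s c p (Or.inl rfl) with h1 | h1 | h1 | h1
      · exact (has h1).elim
      · exact (hac h1).elim
      · exact Or.inl (h1.mono hmono).symm
      · exact Or.inr (h1.mono hmono).symm
    · obtain ⟨p⟩ := h.symm
      rcases reach_pair_avoiding ω s c p (Or.inr rfl) with h1 | h1 | h1 | h1
      · exact (has h1).elim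
      · exact (hac h1).elim
      · exact Or.inl (h1.mono hmono).symm
      · exact Or.inr (h1.mono hmono).symm
  intro ω ω' hF
  exact ⟨key ω ω' hF, key ω' ω hF.symm⟩

/-- **`I_U(sc) = 0`**: the pair `sc` is never pivotal for `U`, `P_{w[sc↦1]}(U) = P_{w[sc↦0]}(U)`. [this work] -/
theorem infl_U_at_sc_eq_zero (has : a ≠ s) (hac : a ≠ c) :
    (prodBernoulli (Function.update w s(s, c) 1)).real (openConn s a ∪ openConn c a : Set (BondConfig V)) =
      (prodBernoulli (Function.update w s(s, c) 0)).real (openConn s a ∪ openConn c a : Set (BondConfig V)) :=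
  prodBernoulli_real_eq_of_determinedBy _ _ (fun i hi => by
    rw [Function.update_of_ne (fun h => hi (mem_singleton_iff.2 h)), Function.update_of_ne (fun h => hi (mem_singleton_iff.2 h))])
    (determinedBy_U_pair has hac) MeasurableSet.of_discrete

end measures

/-! ## (XI♯) at `e = as` -/

/-- **THE SHARP CROSS INEQUALITY AT THE PAIR `as`.**  For every weight function `w` on the pairs of a finite vertex type and distinct
`a, s, c`, with `μ = P_{w[as↦0]}`, `ν = P_{w[as↦1]}`, `U = {s↔a} ∪ {c↔a}`, `D = {s↮c}`, `X = U ∩ D`: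
`4·(ν(U) − μ(U))·(μ(D) − ν(D)) ≤ (2μ(X) − μ(U)μ(D)) + (2ν(X) − ν(U)ν(D))`, i.e. `I_U·I_D ≤ ¼(F(μ) + F(ν))` — gen 45's (XI♯) with
its conjectured sharp constant, at the terminal pair `as`.  [this work] -/
theorem cross_sharp_at_as (w : Sym2 V → unitInterval) {a s c : V} (has : a ≠ s) (hac : a ≠ c) (hsc : s ≠ c) :
    4 * ((prodBernoulli (Function.update w s(a, s) 1)).real (openConn s a ∪ openConn c a : Set (BondConfig V)) -
          (prodBernoulli (Function.update w s(a, s) 0)).real (openConn s a ∪ openConn c a : Set (BondConfig V))) *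
        ((prodBernoulli (Function.update w s(a, s) 0)).real ((openConn s c)ᶜ : Set (BondConfig V)) -
          (prodBernoulli (Function.update w s(a, s) 1)).real ((openConn s c)ᶜ : Set (BondConfig V))) ≤
      (2 * (prodBernoulli (Function.update w s(a, s) 0)).real ((openConn s a ∪ openConn c a) ∩ (openConn s c)ᶜ : Set (BondConfig V)) -
          (prodBernoulli (Function.update w s(a, s) 0)).real (openConn s a ∪ openConn c a : Set (BondConfig V)) *
            (prodBernoulli (Function.update w s(a, s) 0)).real ((openConn s c)ᶜ : Set (BondConfig V))) +
        (2 * (prodBernoulli (Function.update w s(a, s) 1)).real ((openConn s a ∪ openConn c a) ∩ (openConn s c)ᶜ : Set (BondConfig V)) -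
          (prodBernoulli (Function.update w s(a, s) 1)).real (openConn s a ∪ openConn c a : Set (BondConfig V)) *
            (prodBernoulli (Function.update w s(a, s) 1)).real ((openConn s c)ᶜ : Set (BondConfig V))) := by
  set μ := prodBernoulli (Function.update w s(a, s) 0) with hμ
  set ν := prodBernoulli (Function.update w s(a, s) 1) with hν
  -- the ν side
  have nU : ν.real (openConn s a ∪ openConn c a : Set (BondConfig V)) = 1 := nu_real_U w has
  have nD : ν.real ((openConn s c)ᶜ : Set (BondConfig V)) = μ.real ((openConn s c)ᶜ ∩ (openConn c a)ᶜ : Set (BondConfig V)) :=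
    nu_real_D w has (Ne.symm hac) (Ne.symm hsc)
  have nX : ν.real ((openConn s a ∪ openConn c a) ∩ (openConn s c)ᶜ : Set (BondConfig V)) =
      ν.real ((openConn s c)ᶜ : Set (BondConfig V)) := nu_real_X w has
  -- the μ side: events
  set Uev : Set (BondConfig V) := openConn s a ∪ openConn c a with hUev
  set Dev : Set (BondConfig V) := (openConn s c)ᶜ with hDev
  set Cev : Set (BondConfig V) := (openConn s c)ᶜ ∩ (openConn c a)ᶜ with hCev
  set IsoS : Set (BondConfig V) := (openConn s a)ᶜ ∩ (openConn s c)ᶜ with hIsoS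
  set P2 : ℝ := μ.real (Dev ∩ openConn c a) with hP2
  set P1 : ℝ := μ.real (Cev ∩ openConn s a) with hP1
  set q : ℝ := μ.real (Cev \ openConn s a) with hq
  -- μ(D) = P2 + μ(Cev)
  have hD : μ.real Dev = P2 + μ.real Cev := by
    have h := measureReal_inter_add_sdiff (μ := μ) (s := Dev) (t := (openConn c a : Set (BondConfig V))) MeasurableSet.of_discrete
    have e : Dev \ openConn c a = Cev := by ext ω; simp [hDev, hCev]
    rw [e] at h; linarith
  -- μ(Cev) = P1 + q
  have hC : μ.real Cev = P1 + q := by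
    have h := measureReal_inter_add_sdiff (μ := μ) (s := Cev) (t := (openConn s a : Set (BondConfig V))) MeasurableSet.of_discrete
    linarith
  -- μ(X) = P2 + P1
  have hX : μ.real (Uev ∩ Dev) = P2 + P1 := by
    have h := measureReal_inter_add_sdiff (μ := μ) (s := Uev ∩ Dev) (t := (openConn c a : Set (BondConfig V))) MeasurableSet.of_discrete
    have e1 : (Uev ∩ Dev) ∩ openConn c a = Dev ∩ openConn c a := by
      ext ω; simp only [hUev, mem_inter_iff, mem_union]; tauto
    have e2 : (Uev ∩ Dev) \ openConn c a = Cev ∩ openConn s a := by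
      ext ω; simp only [hUev, hCev, hDev, mem_inter_iff, mem_union, mem_sdiff, mem_compl_iff]; tauto
    rw [e1, e2] at h; linarith
  -- μ(IsoS) = P2 + q  and the Harris inequality
  have hI : μ.real IsoS = P2 + q := by
    have h := measureReal_inter_add_sdiff (μ := μ) (s := IsoS) (t := (openConn c a : Set (BondConfig V))) MeasurableSet.of_discrete
    have e1 : IsoS ∩ openConn c a = Dev ∩ openConn c a := by
      ext ω
      simp only [hIsoS, hDev, mem_inter_iff, mem_compl_iff, openConn, mem_setOf_eq]
      constructor
      · rintro ⟨⟨-, h2⟩, h3⟩; exact ⟨h2, h3⟩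
      · rintro ⟨h2, h3⟩; exact ⟨⟨fun h1 => h2 (h1.trans h3.symm), h2⟩, h3⟩
    have e2 : IsoS \ openConn c a = Cev \ openConn s a := by
      ext ω; simp only [hIsoS, hCev, mem_inter_iff, mem_sdiff, mem_compl_iff]; tauto
    rw [e1, e2] at h; linarith
  have hHarris : P2 ≤ μ.real (openConn c a : Set (BondConfig V)) * μ.real IsoS := by
    have e1 : Dev ∩ openConn c a = (openConn c a : Set (BondConfig V)) ∩ IsoS := by
      ext ω
      simp only [hIsoS, hDev, mem_inter_iff, mem_compl_iff, openConn, mem_setOf_eq]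
      constructor
      · rintro ⟨h2, h3⟩; exact ⟨h3, fun h1 => h2 (h1.trans h3.symm), h2⟩
      · rintro ⟨h3, -, h2⟩; exact ⟨h2, h3⟩
    rw [hP2, e1]
    exact prodBernoulli_harris_upper_lower _ (isUpperSet_openConn c a)
      (((isUpperSet_openConn s a).compl).inter (isUpperSet_openConn s c).compl) MeasurableSet.of_discrete MeasurableSet.of_discrete
  have hca_le : μ.real (openConn c a : Set (BondConfig V)) ≤ μ.real Uev := measureReal_mono (by rw [hUev]; exact subset_union_right)
  have hU1 : μ.real Uev ≤ 1 := measureReal_le_one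
  have hP1 : 0 ≤ P1 := measureReal_nonneg
  have hP2n : 0 ≤ P2 := measureReal_nonneg
  have hqn : 0 ≤ q := measureReal_nonneg
  have hUn : 0 ≤ μ.real Uev := measureReal_nonneg
  have hIs : 0 ≤ μ.real IsoS := measureReal_nonneg
  -- P2 ≤ (1 − A)·I_s with A = 1 − μ(U)
  have hH2 : P2 ≤ μ.real Uev * μ.real IsoS := hHarris.trans (mul_le_mul_of_nonneg_right hca_le hIs)
  rw [nX, nU, nD, hX, hD, hC]
  rw [hI] at hH2
  -- goal: 4(1 − μU)·P2 ≤ (2(P2+P1) − μU(P2+P1+q)) + (2(P1+q) − (P1+q))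
  by_cases hA : 4 * (1 - μ.real Uev) ≤ 1
  · nlinarith [mul_nonneg hUn hP2n, mul_nonneg hUn hP1, mul_nonneg hUn hqn]
  · nlinarith [hH2, mul_nonneg hUn hP1, sq_nonneg (1 - 2 * μ.real Uev), mul_nonneg (mul_nonneg hP2n hUn) hUn,
      mul_nonneg (mul_nonneg hqn hUn) hUn]

end HalvingCross

end Summit.CriticalPhenomena.PercolationContinuityZ3.Theorems

end
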